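import Summits.HodgeConjecture.CorCM.MumfordTateRankRibetTypeOnePairsExact
import HarnessLib

/-!
# Two Ribet-type `(g−1,1)` abelian varieties of the same dimension: the trichotomy `t(A × A′) = g² + 1 / 2g² / 2g² + 1`
# (`A ∼ A′` / `A ≁ A′` with isomorphic fields / non-isomorphic fields) — matched roots from a ring homomorphism `End⁰A′ → End⁰A`

COR-CM (cell `pub-hodgecm2`, seat `b27` gen 53, count-neutral Mumford–Tate-rank ladder; theorems only, no definition, no named fact; UNCONDITIONAL —
nothing here uses or asserts HC_CM).  `t := dim MT(H¹·)`.  Sequel of `CorCM/MumfordTateRankRibetTypeOnePairsExact`, whose cell `2g²` is stated for a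
COMMON root `φ ∘ φ = −D = φ′ ∘ φ′`.  HERE the common root is produced from any ring homomorphism `f : End⁰A′ → End⁰A`: if `φ ∘ φ = −d` on `A` and
`φ′ ∘ φ′ = −d′` on `A′` (`dim_ℚ End⁰A = 2`), then `f(φ′) = ±(a/b)φ` in `End⁰A = ℚ(φ)`, so `a²d = b²d′ =: D` and `aφ`, `bφ′` have the common root
`−D` with the SAME multiplicities (`n_{aρ}(aφ) = n_ρ(φ)`), in particular multiplicity one is kept.  Whence, for two Ribet-type `(g−1,1)` varieties
of the same dimension `g ≥ 3` given with arbitrary roots: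
* §1 `eigenMultiplicity_nsmul` (`n_{nρ}(A, nφ) = n_ρ(A, φ)`), `exists_sq_mul_eq_of_ringHom` (`a²d = b²d′`),
  **`exists_matched_data_of_ringHom_ribetTypeOne`** (common root `D`, multiplicity one on both sides);
* §2 **`mtRank_hodge_one_eq_of_isIsogenous_prod_ribetTypeOne_of_nonempty_ringHom`** — `A ≁ A′`, ISOMORPHIC fields: `t(X) = 2g²` for
  `X ∼ A × A′`; **`mtRank_hodge_one_trichotomy_of_isIsogenous_prod_ribetTypeOne`** — `t(X) = g² + 1` (`A ∼ A′`), `2g²` (`A ≁ A′`, `End⁰A ≅ End⁰A′`),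
  `2g² + 1` (`End⁰A ≇ End⁰A′`): Moonen–Zarhinʼs threefold trichotomy `10 / 18 / 19` (gen 52) in every dimension.

## References
* [MoonenZarhin1999LowDim] B. Moonen, Yu. G. Zarhin, *Hodge classes on abelian varieties of low dimension*, Math. Ann. 315 (1999), §3 (3.1),
  Lemma (3.4), Prop. (3.8), Thm. 0.1 (4) [corpus: paper:arxiv-math_9901113 pp. 1–7]. [cite: MoonenZarhin1999LowDim, §3 (3.1), Lemma (3.4) and Prop. (3.8)]
* [Ribet1983] K. A. Ribet, *Hodge classes on certain types of abelian varieties*, Amer. J. Math. 105 (1983), Thm. 3. [cite: Ribet1983, Thm. 3]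
* [MumfordAV1970] D. Mumford, *Abelian varieties*, §19 Thm. 3 and Cor. 2 (`End⁰` of isogenous varieties; `End ⊗ ℚ`). [cite: MumfordAV1970, §19 Thm. 3 and Cor. 2]
* [Shimura1998] G. Shimura, *Abelian varieties with complex multiplication and modular functions* (1998), §5.1 Prop. 5 (quadratic algebras).
  [cite: Shimura1998, §5.1 Proposition 5 (p. 36)]
* [LangeBirkenhake1992] H. Lange, Ch. Birkenhake, *Complex Abelian Varieties* (1992), §1.1 (the analytic representation is additive). [cite: LangeBirkenhake1992, §1.1 (p. 19)]
-/

noncomputable section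

open scoped TensorProduct
open CategoryTheory CategoryTheory.Limits Module NumberField

namespace Summit.HodgeConjecture.CorCM

open Literature.AlgebraicGeometry.Motives
open Literature.AlgebraicGeometry.Motives.AbelianVariety
open Literature.AlgebraicGeometry.Motives.HodgeStructure
open Literature.AlgebraicGeometry.HodgeTheory
open Literature.AlgebraicGeometry.ComplexMultiplication

variable {A A' : AbelianVariety ℂ}

/-! ## §1 Matched roots from a ring homomorphism `End⁰A′ → End⁰A` -/

/-- **`n_{nρ}(A, n·φ) = n_ρ(A, φ)`** (`n ≠ 0`): `(n·φ)^* = n·φ^*` on `H¹` (the analytic/rational representation is additive), and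
`ker(nφ^* − nρ) = ker(φ^* − ρ)`. [cite: LangeBirkenhake1992, §1.1 (p. 19)] -/
theorem eigenMultiplicity_nsmul (φ : A ⟶ A) {n : ℕ} (hn : n ≠ 0) (ρ : ℂ) :
    eigenMultiplicity A (n • φ) ((n : ℂ) * ρ) = eigenMultiplicity A φ ρ := by
  have hn' : (n : ℂ) ≠ 0 := Nat.cast_ne_zero.2 hn
  have hE : Module.End.eigenspace (complexBetti.map (n • φ).hom.hom.hom 1).hom ((n : ℂ) * ρ) =
      Module.End.eigenspace (complexBetti.map φ.hom.hom.hom 1).hom ρ := by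
    rw [complexBetti_map_nsmul_one]
    ext x
    rw [Module.End.mem_eigenspace_iff, Module.End.mem_eigenspace_iff, ModuleCat.hom_nsmul, LinearMap.smul_apply, ← Nat.cast_smul_eq_nsmul ℂ,
      mul_smul]
    exact (smul_right_injective _ hn').eq_iff
  unfold eigenMultiplicity
  rw [hE]

/-- **`a²d = b²d′` from a ring homomorphism `End⁰A′ → End⁰A`** (`φ ∘ φ = −d` on `A`, `φ′ ∘ φ′ = −d′` on `A′`, `dim_ℚ End⁰A = 2`): the image
`c = f(φ′)` is `x + yφ` in `End⁰A = ℚ + ℚφ` with `c² = −d′`, and `(x + yφ)² = (x² − dy²) + 2xyφ` forces `x = 0`, `dy² = d′`, `y = ±a/b`.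
[cite: Shimura1998, §5.1 Proposition 5 (p. 36)] [cite: MumfordAV1970, §19 Thm. 3 and Cor. 2] -/
theorem exists_sq_mul_eq_of_ringHom (f : A'.endAlgebra →+* A.endAlgebra) (hAE : Module.finrank ℚ A.endAlgebra = 2)
    {φ : A ⟶ A} {d : ℕ} (hd : 0 < d) (hφ : φ ≫ φ = -(d • 𝟙 A)) {φ' : A' ⟶ A'} {d' : ℕ} (hd' : 0 < d') (hφ' : φ' ≫ φ' = -(d' • 𝟙 A')) :
    ∃ a b : ℕ, 0 < a ∧ 0 < b ∧ a * a * d = b * b * d' := by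
  haveI : Module.Finite ℚ A.endAlgebra := AbelianVariety.finiteDimensional_endAlgebra_holds A
  haveI : Nontrivial A.endAlgebra := Module.nontrivial_of_finrank_pos (R := ℚ) (by rw [hAE]; norm_num)
  have ha := endAlgebra_of_mul_self_eq_neg hφ
  have hc : f (endAlgebra.of A' φ') * f (endAlgebra.of A' φ') = -((d' : ℚ) • 1) := by
    rw [← map_mul, endAlgebra_of_mul_self_eq_neg hφ', map_neg, Nat.cast_smul_eq_nsmul, Nat.cast_smul_eq_nsmul, map_nsmul, map_one]
  have hdQ : (0 : ℚ) < d := Nat.cast_pos.2 hd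
  obtain ⟨x, y, hxy⟩ := exists_eq_smul_one_add_smul_of_sq_eq_neg hAE hdQ ha (f (endAlgebra.of A' φ'))
  set e : A.endAlgebra := endAlgebra.of A φ with he
  -- `(x + ye)² = (x² − dy²) + 2xy e = −d'`
  have hsq : (x * x - d * (y * y) + d') • (1 : A.endAlgebra) + (2 * x * y) • e = 0 := by
    have h : (x • (1 : A.endAlgebra) + y • e) * (x • 1 + y • e) = (x * x - d * (y * y)) • 1 + (x * y + x * y) • e := by
      simp only [add_mul, mul_add, smul_mul_smul_comm, one_mul, mul_one, ha, smul_neg, smul_smul]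
      module
    rw [← hxy, hc] at h
    have h2 : (x * x - d * (y * y) + d') • (1 : A.endAlgebra) + (2 * x * y) • e = ((x * x - d * (y * y)) • 1 + (x * y + x * y) • e) + (d' : ℚ) • 1 := by
      module
    rw [h2, ← h, neg_add_cancel]
  -- `e` is not a rational scalar, so `2xy = 0`: else `(2xy e)² = s²` and `= −(2xy)²d`
  have hxy0 : 2 * x * y = 0 := by
    by_contra hne
    have h1 : (2 * x * y) • e = -((x * x - d * (y * y) + d') • (1 : A.endAlgebra)) := eq_neg_of_add_eq_zero_right hsq
    have hA : ((2 * x * y) • e) * ((2 * x * y) • e) = -(((2 * x * y) * (2 * x * y) * d) • (1 : A.endAlgebra)) := by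
      rw [smul_mul_smul_comm, ha, smul_neg, smul_smul]
    have hB : ((2 * x * y) • e) * ((2 * x * y) • e) = ((x * x - d * (y * y) + d') * (x * x - d * (y * y) + d')) • (1 : A.endAlgebra) := by
      rw [h1, neg_mul_neg, smul_mul_smul_comm, one_mul]
    have hC : ((x * x - d * (y * y) + d') * (x * x - d * (y * y) + d') + (2 * x * y) * (2 * x * y) * d) • (1 : A.endAlgebra) = 0 := by
      rw [add_smul, ← hB, hA, neg_add_cancel]
    rw [smul_eq_zero] at hC
    rcases hC with h | h
    · nlinarith [mul_self_nonneg (x * x - d * (y * y) + d'), mul_pos (mul_self_pos.2 hne) hdQ]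
    · exact one_ne_zero h
  rw [hxy0, zero_smul, add_zero, smul_eq_zero] at hsq
  have hrel : x * x - d * (y * y) + d' = 0 := hsq.resolve_right one_ne_zero
  have hx : x = 0 := by
    rcases mul_eq_zero.1 hxy0 with h | h
    · rcases mul_eq_zero.1 h with h | h
      · norm_num at h
      · exact h
    · exfalso
      rw [h, mul_zero, mul_zero, sub_zero] at hrel
      nlinarith [mul_self_nonneg x, (Nat.cast_pos (α := ℚ)).2 hd']
  rw [hx, mul_zero, zero_sub] at hrel
  -- `d y² = d'` with `y = num/den`
  have hyrel : (d : ℚ) * (y * y) = d' := by linarith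
  have hy0 : y ≠ 0 := by
    rintro rfl
    rw [mul_zero, mul_zero] at hyrel
    exact (Nat.cast_ne_zero.2 hd'.ne') hyrel.symm
  refine ⟨y.num.natAbs, y.den, Int.natAbs_pos.2 (Rat.num_ne_zero.2 hy0), y.den_pos, ?_⟩
  have hy : (y.num : ℚ) = y * y.den := by
    have h := Rat.num_div_den y
    field_simp at h ⊢
    linarith [h]
  have hnum : ((y.num.natAbs : ℕ) : ℚ) * ((y.num.natAbs : ℕ) : ℚ) = (y.num : ℚ) * (y.num : ℚ) := by
    have h := congrArg (Int.cast : ℤ → ℚ) (Int.natAbs_mul_self' y.num)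
    push_cast at h
    rw [← Int.cast_natCast y.num.natAbs, Int.natCast_natAbs, Int.cast_abs]
    exact h
  have h : ((y.num.natAbs * y.num.natAbs * d : ℕ) : ℚ) = ((y.den * y.den * d' : ℕ) : ℚ) := by
    push_cast
    rw [hnum, hy, ← hyrel]
    ring
  exact_mod_cast h

/-- **MATCHED DATA FROM A RING HOM `End⁰A′ → End⁰A`** for Ribet-type data with multiplicity one: from `φ ∘ φ = −d`, `φ′ ∘ φ′ = −d′` (multiplicity
one at `± i√d`, `± i√d′`) and `f : End⁰A′ → End⁰A`, the endomorphisms `aφ`, `bφ′` (`a²d = b²d′ = D`) have the common root `−D` and still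
multiplicity one at `± i√D`. [cite: MumfordAV1970, §19 Thm. 3 and Cor. 2] [cite: MoonenZarhin1999LowDim, §2 (2.3)] -/
theorem exists_matched_data_of_ringHom_ribetTypeOne (f : A'.endAlgebra →+* A.endAlgebra) (hAE : Module.finrank ℚ A.endAlgebra = 2) (φ : A ⟶ A) {d : ℕ} (hd : 0 < d) (hφ : φ ≫ φ = -(d • 𝟙 A))
    (h1 : eigenMultiplicity A φ (Complex.I * (Real.sqrt d : ℂ)) = 1 ∨ eigenMultiplicity A φ (-(Complex.I * (Real.sqrt d : ℂ))) = 1)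
    (φ' : A' ⟶ A') {d' : ℕ} (hd' : 0 < d') (hφ' : φ' ≫ φ' = -(d' • 𝟙 A'))
    (h1' : eigenMultiplicity A' φ' (Complex.I * (Real.sqrt d' : ℂ)) = 1 ∨ eigenMultiplicity A' φ' (-(Complex.I * (Real.sqrt d' : ℂ))) = 1) :
    ∃ (φ₁ : A ⟶ A) (φ₁' : A' ⟶ A') (D : ℕ), 0 < D ∧ φ₁ ≫ φ₁ = -(D • 𝟙 A) ∧ φ₁' ≫ φ₁' = -(D • 𝟙 A') ∧
      (eigenMultiplicity A φ₁ (Complex.I * (Real.sqrt D : ℂ)) = 1 ∨ eigenMultiplicity A φ₁ (-(Complex.I * (Real.sqrt D : ℂ))) = 1) ∧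
      (eigenMultiplicity A' φ₁' (Complex.I * (Real.sqrt D : ℂ)) = 1 ∨ eigenMultiplicity A' φ₁' (-(Complex.I * (Real.sqrt D : ℂ))) = 1) := by
  obtain ⟨a, b, ha, hb, hab⟩ := exists_sq_mul_eq_of_ringHom f hAE hd hφ hd' hφ'
  have hsq : ∀ (c e : ℕ), (Real.sqrt ((c * c * e : ℕ) : ℝ) : ℂ) = (c : ℂ) * (Real.sqrt e : ℂ) := fun c e => by
    rw [Nat.cast_mul, Nat.cast_mul, Real.sqrt_mul (mul_self_nonneg _), Real.sqrt_mul_self (Nat.cast_nonneg c)]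
    push_cast
    ring
  have hcomp : ∀ {B : AbelianVariety ℂ} (χ : B ⟶ B) (c e : ℕ), χ ≫ χ = -(e • 𝟙 B) → (c • χ) ≫ (c • χ) = -((c * c * e) • 𝟙 B) :=
    fun χ c e hχ => by rw [Preadditive.nsmul_comp, Preadditive.comp_nsmul, hχ, smul_neg, smul_neg, smul_smul, smul_smul]
  have hmult : ∀ {B : AbelianVariety ℂ} (χ : B ⟶ B) (c e : ℕ), 0 < c →
      (eigenMultiplicity B χ (Complex.I * (Real.sqrt e : ℂ)) = 1 ∨ eigenMultiplicity B χ (-(Complex.I * (Real.sqrt e : ℂ))) = 1) →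
      (eigenMultiplicity B (c • χ) (Complex.I * (Real.sqrt ((c * c * e : ℕ) : ℝ) : ℂ)) = 1 ∨
        eigenMultiplicity B (c • χ) (-(Complex.I * (Real.sqrt ((c * c * e : ℕ) : ℝ) : ℂ))) = 1) := by
    intro B χ c e hc h
    have e1 : Complex.I * (Real.sqrt ((c * c * e : ℕ) : ℝ) : ℂ) = (c : ℂ) * (Complex.I * (Real.sqrt e : ℂ)) := by rw [hsq]; ring
    rw [e1, ← mul_neg, eigenMultiplicity_nsmul χ hc.ne', eigenMultiplicity_nsmul χ hc.ne']
    exact h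
  refine ⟨a • φ, b • φ', a * a * d, Nat.mul_pos (Nat.mul_pos ha ha) hd, hcomp φ a d hφ, ?_, ?_, ?_⟩
  · rw [hab]; exact hcomp φ' b d' hφ'
  · have h := hmult φ a d ha h1
    rwa [Nat.cast_mul, Nat.cast_mul] at h ⊢
  · have h := hmult φ' b d' hb h1'
    rw [hab]
    rwa [Nat.cast_mul, Nat.cast_mul] at h ⊢

/-! ## §2 Isomorphic fields: `t = 2g²`; the trichotomy `g² + 1 / 2g² / 2g² + 1` -/

variable [HodgeTensorFacts.{0, 0}] {X : AbelianVariety ℂ} {n : ℕ}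

/-- **`t(X) = 2g²` for `X ∼ A × A′`, `A ≁ A′` of Ribet type `(g−1,1)` of the same dimension with ISOMORPHIC fields** (a ring homomorphism
`End⁰A′ → End⁰A`): matched roots (§1) and `mtRank_hodge_one_eq_of_isIsogenous_prod_ribetTypeOne_of_comp_self_eq_neg`.
[cite: MoonenZarhin1999LowDim, §3 (3.1), Lemma (3.4) and Thm. 0.1 (4)] [cite: Ribet1983, Thm. 3] -/
theorem mtRank_hodge_one_eq_of_isIsogenous_prod_ribetTypeOne_of_nonempty_ringHom (hX : IsSmoothProjective n X.X)
    (hF : IsField A.endAlgebra) (hnR : ¬ IsTotallyReal (EndField A hF)) (φ : A ⟶ A) {d : ℕ} (hd : 0 < d) (hφ : φ ≫ φ = -(d • 𝟙 A))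
    (hAE : Module.finrank ℚ A.endAlgebra = 2)
    (h1 : eigenMultiplicity A φ (Complex.I * (Real.sqrt d : ℂ)) = 1 ∨ eigenMultiplicity A φ (-(Complex.I * (Real.sqrt d : ℂ))) = 1) (hdim : 3 ≤ A.dim)
    (hF' : IsField A'.endAlgebra) (hnR' : ¬ IsTotallyReal (EndField A' hF')) (φ' : A' ⟶ A') {d' : ℕ} (hd' : 0 < d') (hφ' : φ' ≫ φ' = -(d' • 𝟙 A'))
    (hA'E : Module.finrank ℚ A'.endAlgebra = 2)
    (h1' : eigenMultiplicity A' φ' (Complex.I * (Real.sqrt d' : ℂ)) = 1 ∨ eigenMultiplicity A' φ' (-(Complex.I * (Real.sqrt d' : ℂ))) = 1)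
    (hdd : A'.dim = A.dim) (hfor : Nonempty (A'.endAlgebra →+* A.endAlgebra)) (hni : ¬ IsIsogenous A A') (hXP : IsIsogenous X (A.prod A')) :
    haveI := BettiUniverse.finite hX 1
    (BettiUniverse.hodge exists_isReal_hodgeModel_holds hX 1).mtRank = 2 * (A.dim * A.dim) := by
  obtain ⟨f⟩ := hfor
  obtain ⟨φ₁, φ₁', D, hD, hφ₁, hφ₁', h1₁, h1₁'⟩ := exists_matched_data_of_ringHom_ribetTypeOne f hAE φ hd hφ h1 φ' hd' hφ' h1'
  exact mtRank_hodge_one_eq_of_isIsogenous_prod_ribetTypeOne_of_comp_self_eq_neg hX hF hnR φ₁ hD hφ₁ hAE h1₁ hF' hnR' φ₁' hφ₁' hA'E h1₁' hdim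
    hdd hni hXP

/-- **Trichotomy for two Ribet-type `(g−1,1)` abelian varieties of the same dimension `g ≥ 3`: `t(A × A′) = g² + 1`, `2g²` or `2g² + 1`**
according as `A ∼ A′`; `A ≁ A′` with isomorphic fields; non-isomorphic fields — Moonen–Zarhinʼs threefold trichotomy `10 / 18 / 19` in every
dimension. [cite: MoonenZarhin1999LowDim, §3 (3.1), Lemma (3.4), Prop. (3.8) and Thm. 0.1 (4)] [cite: Ribet1983, Thm. 3] -/
theorem mtRank_hodge_one_trichotomy_of_isIsogenous_prod_ribetTypeOne (hX : IsSmoothProjective n X.X)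
    (hF : IsField A.endAlgebra) (hnR : ¬ IsTotallyReal (EndField A hF)) (φ : A ⟶ A) {d : ℕ} (hd : 0 < d) (hφ : φ ≫ φ = -(d • 𝟙 A))
    (hAE : Module.finrank ℚ A.endAlgebra = 2)
    (h1 : eigenMultiplicity A φ (Complex.I * (Real.sqrt d : ℂ)) = 1 ∨ eigenMultiplicity A φ (-(Complex.I * (Real.sqrt d : ℂ))) = 1) (hdim : 3 ≤ A.dim)
    (hF' : IsField A'.endAlgebra) (hnR' : ¬ IsTotallyReal (EndField A' hF')) (φ' : A' ⟶ A') {d' : ℕ} (hd' : 0 < d') (hφ' : φ' ≫ φ' = -(d' • 𝟙 A'))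
    (hA'E : Module.finrank ℚ A'.endAlgebra = 2)
    (h1' : eigenMultiplicity A' φ' (Complex.I * (Real.sqrt d' : ℂ)) = 1 ∨ eigenMultiplicity A' φ' (-(Complex.I * (Real.sqrt d' : ℂ))) = 1)
    (hdd : A'.dim = A.dim) (hXP : IsIsogenous X (A.prod A')) :
    haveI := BettiUniverse.finite hX 1
    (IsIsogenous A A' ∧ (BettiUniverse.hodge exists_isReal_hodgeModel_holds hX 1).mtRank = A.dim * A.dim + 1) ∨
      (¬ IsIsogenous A A' ∧ Nonempty (A'.endAlgebra →+* A.endAlgebra) ∧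
        (BettiUniverse.hodge exists_isReal_hodgeModel_holds hX 1).mtRank = 2 * (A.dim * A.dim)) ∨
      (IsEmpty (A'.endAlgebra →+* A.endAlgebra) ∧ (BettiUniverse.hodge exists_isReal_hodgeModel_holds hX 1).mtRank = 2 * (A.dim * A.dim) + 1) := by
  haveI := BettiUniverse.finite hX 1
  by_cases hAA' : IsIsogenous A A'
  · left
    have hT : IsSmoothProjective A.dim A.X := AbelianVariety.isSmoothProjective_holds
    haveI := BettiUniverse.finite hT 1
    refine ⟨hAA', ?_⟩
    rw [mtRank_hodge_one_eq_of_isIsogenous_powSucc hX hT (by omega) (m := 1) (hXP.trans ((IsIsogenous.refl A).prod hAA'.symm')),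
      (mtRank_hodge_one_of_ribetTypeOne' hT hF hnR φ hd hφ hAE h1 hdim).1]
  · right
    rcases isEmpty_or_nonempty (A'.endAlgebra →+* A.endAlgebra) with hfor | hfor
    · right
      refine ⟨hfor, ?_⟩
      rw [mtRank_hodge_one_eq_of_isIsogenous_prod_ribetTypeOne_of_isEmpty_ringHom hX hF hnR φ hd hφ hAE h1 hdim hF' hnR' φ' hd' hφ' hA'E h1'
        (by omega) hfor hXP, hdd]
      ring
    · left
      exact ⟨hAA', hfor, mtRank_hodge_one_eq_of_isIsogenous_prod_ribetTypeOne_of_nonempty_ringHom hX hF hnR φ hd hφ hAE h1 hdim hF' hnR' φ' hd'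
        hφ' hA'E h1' hdd hfor hAA' hXP⟩

end Summit.HodgeConjecture.CorCM

end
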